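import Literature.Geometry.Lorentzian.CauchyHypersurfaceCausalProofs
import Literature.Geometry.Lorentzian.CausalityOpennessProofs
import Literature.Geometry.Lorentzian.CausalityAchronalProofs

/-!
# Route SwallowTheDatum · item `SubdataDevelopmentsEmbed` (stmt-FinalStateConjecture-10053) —
# towards `hncb`, III: the domain of dependence of `K ⊆ Σ` is closed off `Σ`

For a Cauchy hypersurface `Σ` and any `K ⊆ Σ` write
`D(K) = {x | every endless timelike curve through x meets K}` (inline, no definition). Then
`closure D(K) ∖ Σ ⊆ D(K)`: if `x_k → q ∉ Σ` with `x_k ∈ D(K)` and `γ` is an endless timelike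
curve through `q` crossing `Σ` at `γ t*` (before `q`, say), the bent-endpoint lemma
(`LorentzianMetric.eventually_exists_isFutureTimelikeCurveOn`, O'Neill 1983, Lemma 14.3) gives a
future timelike curve from `γ t*` to `x_k` for `k` large, hence an endless timelike curve through
`γ t*` and `x_k` (`exists_isEndlessTimelikeCurve_extends`); it meets `K ⊆ Σ` (as `x_k ∈ D(K)`)
and `Σ` only once, so `γ t* ∈ K`. The case of a crossing after `q` is the time dual. This is the
soft half of Hawking–Ellis 1973, Prop. 6.5.1 (`D̃⁺(S)` is closed for closed `S`; here for any `K`,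
off `Σ`), the form needed for the horizon step of `hncb` (a cluster value, off `Σ`, of points
whose endless timelike curves cross `Σ` inside a fixed `K ⋐ S` has the same property).

* `mem_of_mem_closure_DoD_of_lt` — the one-sided statement (crossing before `q`);
* `mem_DoD_of_mem_closure_DoD` — `q ∈ closure D(K)`, `q ∉ Σ` ⟹ `q ∈ D(K)`.

No definition, no named fact.
-/

noncomputable section

open Function Set Filter Topology TopologicalSpace Bundle Manifold
open scoped Manifold ContDiff Topology

namespace Summit.FinalStateConjecture.FinalStateConjecture.Theorems

namespace SubdataDevelopmentsEmbed

open Literature.Geometry.Lorentzian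

section Closed

variable {E : Type*} [NormedAddCommGroup E] [NormedSpace ℝ E] {H : Type*} [TopologicalSpace H]
  {I : ModelWithCorners ℝ E H} {n : ℕ∞ω} {M : Type*} [TopologicalSpace M] [ChartedSpace H M]
  [IsManifold I ∞ M] {g : LorentzianMetric I n M} {τ : TimeOrientation g}
  [T2Space M] [SecondCountableTopology M] [BoundarylessManifold I M] [FiniteDimensional ℝ E]

/-- **`closure D(K) ∖ Σ ⊆ D(K)`, one-sided form.** Let `Σ` be a Cauchy hypersurface, `K ⊆ Σ`,
`q` in the closure of `D(K) = {x | every endless timelike curve through x meets K}`, and `γ` an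
endless timelike curve through `q = γ t₀` with `γ t* ∈ Σ` for some parameter `t* < t₀`. Then
`γ t* ∈ K`. (Bent-endpoint lemma, extension to an endless curve, uniqueness of the crossing.)
Hawking–Ellis 1973, Prop. 6.5.1 (soft half); O'Neill 1983, Lemma 14.3. -/
theorem mem_of_mem_closure_DoD_of_lt (hn : 2 ≤ n) {Sig K : Set M}
    (hSig : g.IsCauchyHypersurface τ Sig) (hK : K ⊆ Sig) {q : M}
    (hq : q ∈ closure {x : M | ∀ (δ : ℝ → M) (u : Set ℝ), g.IsEndlessTimelikeCurve τ δ u →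
      ∀ r ∈ u, δ r = x → ∃ r' ∈ u, δ r' ∈ K})
    {γ : ℝ → M} {u : Set ℝ} (hγ : g.IsEndlessTimelikeCurve τ γ u) {t₀ tS : ℝ} (ht₀ : t₀ ∈ u)
    (htS : tS ∈ u) (hlt : tS < t₀) (hγt₀ : γ t₀ = q) (hγtS : γ tS ∈ Sig) : γ tS ∈ K := by
  have hseg : g.IsFutureTimelikeCurveOn τ γ (Icc tS t₀) := hγ.2.1.mono (hγ.1.out htS ht₀)
  have hev := LorentzianMetric.eventually_exists_isFutureTimelikeCurveOn hlt hseg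
  rw [hγt₀] at hev
  obtain ⟨y, ⟨Γ, b', hb', hΓ, hΓa, hΓb⟩, hyD⟩ := mem_closure_iff_nhds.mp hq _ hev
  obtain ⟨Δ, D, hΔ, haD, hbD, hΔa, hΔb⟩ :=
    LorentzianMetric.exists_isEndlessTimelikeCurve_extends hn hb' hΓ
  -- the endless curve `Δ` passes through `γ t* ∈ Σ` and `y ∈ D(K)`
  obtain ⟨r', hr'D, hr'K⟩ := hyD Δ D hΔ b' hbD (by rw [hΔb, hΓb])
  obtain ⟨t₁, -, huniq⟩ := hSig Δ D hΔ
  have e1 : r' = t₁ := huniq r' ⟨hr'D, hK hr'K⟩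
  have e2 : tS = t₁ := huniq tS ⟨haD, by rw [hΔa, hΓa]; exact hγtS⟩
  rw [← hΓa, ← hΔa, e2, ← e1]
  exact hr'K

/-- **The domain of dependence of `K ⊆ Σ` is closed off `Σ`**: for a Cauchy hypersurface `Σ`,
`K ⊆ Σ` and `q ∉ Σ` in the closure of `D(K) = {x | every endless timelike curve through x meets
K}`, every endless timelike curve through `q` meets `K` (`mem_of_mem_closure_DoD_of_lt` and its
time dual, by reversing the time orientation and the parameter). Hawking–Ellis 1973, Prop. 6.5.1
(soft half). -/
theorem mem_DoD_of_mem_closure_DoD (hn : 2 ≤ n) {Sig K : Set M}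
    (hSig : g.IsCauchyHypersurface τ Sig) (hK : K ⊆ Sig) {q : M} (hqS : q ∉ Sig)
    (hq : q ∈ closure {x : M | ∀ (δ : ℝ → M) (u : Set ℝ), g.IsEndlessTimelikeCurve τ δ u →
      ∀ r ∈ u, δ r = x → ∃ r' ∈ u, δ r' ∈ K}) :
    ∀ (γ : ℝ → M) (u : Set ℝ), g.IsEndlessTimelikeCurve τ γ u →
      ∀ t ∈ u, γ t = q → ∃ t' ∈ u, γ t' ∈ K := by
  intro γ u hγ t₀ ht₀ hγt₀
  obtain ⟨tS, ⟨htS, hγtS⟩, -⟩ := hSig γ u hγ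
  rcases lt_trichotomy tS t₀ with hlt | heq | hgt
  · exact ⟨tS, htS, mem_of_mem_closure_DoD_of_lt hn hSig hK hq hγ ht₀ htS hlt hγt₀ hγtS⟩
  · exact absurd (heq ▸ hγtS) (hγt₀ ▸ hqS : γ t₀ ∉ Sig)
  · -- crossing after `q`: reverse the time orientation and the parameter
    have hγ' : g.IsEndlessTimelikeCurve τ.reverse (fun t ↦ γ (-t)) (Neg.neg ⁻¹' u) :=
      ⟨ordConnected_preimage_neg hγ.1, hγ.2.1.comp_neg, isFutureEndless_comp_neg_iff.mpr hγ.2.2.2,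
        isPastEndless_comp_neg_iff.mpr hγ.2.2.1⟩
    -- `D(K)` for `τ` is contained in `D(K)` for `τ.reverse`
    have hsub : {x : M | ∀ (δ : ℝ → M) (u : Set ℝ), g.IsEndlessTimelikeCurve τ δ u →
        ∀ r ∈ u, δ r = x → ∃ r' ∈ u, δ r' ∈ K} ⊆
        {x : M | ∀ (δ : ℝ → M) (u : Set ℝ), g.IsEndlessTimelikeCurve τ.reverse δ u →
          ∀ r ∈ u, δ r = x → ∃ r' ∈ u, δ r' ∈ K} := by
      intro x hx δ v hδ r hr hδr
      have hδ' : g.IsEndlessTimelikeCurve τ (fun t ↦ δ (-t)) (Neg.neg ⁻¹' v) :=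
        ⟨ordConnected_preimage_neg hδ.1,
          LorentzianMetric.isFutureTimelikeCurveOn_reverse_reverse_iff.mp hδ.2.1.comp_neg,
          isFutureEndless_comp_neg_iff.mpr hδ.2.2.2, isPastEndless_comp_neg_iff.mpr hδ.2.2.1⟩
      obtain ⟨r', hr', hK'⟩ := hx _ _ hδ' (-r) (by simpa using hr) (by simpa using hδr)
      exact ⟨-r', hr', hK'⟩
    have hq' := closure_mono hsub hq
    have h := mem_of_mem_closure_DoD_of_lt (τ := τ.reverse) hn hSig.reverse hK hq' hγ'
      (t₀ := -t₀) (tS := -tS) (by simpa using ht₀) (by simpa using htS) (by linarith)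
      (by simpa using hγt₀) (by simpa using hγtS)
    exact ⟨tS, htS, by simpa using h⟩

end Closed

end SubdataDevelopmentsEmbed

end Summit.FinalStateConjecture.FinalStateConjecture.Theorems

end
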